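import Summits.Ventures.Crystal3D.Theorems.StickyWulffConstantGenericWallFloorBarlowRowCovGlue
import Summits.Ventures.Crystal3D.Theorems.StickyWulffConstantGenericWallFloorStarFarHolds
import Summits.Ventures.Crystal3D.Theorems.StickyWulffConstantGenericWallFloorOfP5Exhaustion
import HarnessLib

/-!
# TexShadow v6.13 progress marker: the ROW-COVERED generic wall part at the POSITIONAL key `OffR := BarlowPairOffReach`, modulo E1
# (lane T, crux `TextureLiminf`, stmt-Ventures-19483; registered line `TexShadow`; cf-p1 g29 INBOX 19:39:56Z / 20:04:01Z `rowCov_positional`)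

HONEST FRAMING. Venture `Summits/Ventures/Crystal3D` (cell `crystal3d-full`), helper `--supports` the crux `TextureLiminf`
(stmt-Ventures-19483) of `route-Ventures-StickyWulffConstant`, registered line `TexShadow`.  Rung credit only; F-C1 not moved.
NOT the stub `stub_bilayerWallRowCov : ∃ R, BilayerWallRowCovFrom FramesApart R` (that waits for lane G's `barlow_rowhlines_apart`):
this is the SUPPORT theorem at the positional key, recorded as a progress marker.

* **`rowCov_positional : P5Exhaustion → ∃ R, 1 ≤ R ∧ BilayerWallRowCovFrom BarlowPairOffReach R`** (`R = 6`): lane G's positional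
  row-corner machine `barlow_rowhlines` (19480-p2 g8, p663594 ✓) in lane T's `hlines` shape, already closed on the T side as
  `bilayerWallRowCovFrom_barlowPairOffReach`, with its two `StarPairFar` inputs DISCHARGED by the tree theorem `StarFar.starPairFar_holds`
  (p636422 ✓) and E1 (`P5Exhaustion`, certified outside the kernel: R38/R39c) carried as the hypothesis — exactly the inputs of the
  closed walker-covered stub.
GRADE: COMPUTATIONAL — `StarFar.starPairFar_holds` is the kernel B&B of wulff-p2 g12 (compiled `native_decide` evaluations
`StarFar.tasks*_ok`, `allCertOK_ok`, `tasks_cover`); the hypothesis-carrying form with `hDS hCP` explicit is 19480-p2's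
`bilayerWallRowCovFrom_barlowPairOffReach` (standard axioms).
WHAT THIS IS NOT: not the `FramesApart`-keyed stub; E1 is not discharged here; F-C1 not moved.
-/

noncomputable section

namespace Summit.Ventures.Crystal3D.Cruxes.TextureLiminf.TexShadow

open Summit.Ventures.Crystal3D Summit.Ventures.Crystal3D.Theorems

/-- **Row-covered generic walls at the positional key, modulo E1**: `P5Exhaustion → ∃ R ≥ 1, BilayerWallRowCovFrom BarlowPairOffReach R`. -/
theorem rowCov_positional (hE1 : P5Exhaustion) : ∃ R : ℝ, 1 ≤ R ∧ BilayerWallRowCovFrom BarlowPairOffReach R := by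
  obtain ⟨sE, hsE, hcert⟩ := exactOnly_star_of_p5Exhaustion hE1
  exact ⟨6, by norm_num, bilayerWallRowCovFrom_barlowPairOffReach hsE hcert
    (doubleStarCoaxialAt_of_starPairFar StarFar.starPairFar_holds) (capPairCoaxial_of_starPairFar StarFar.starPairFar_holds)⟩

end Summit.Ventures.Crystal3D.Cruxes.TextureLiminf.TexShadow

end
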